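import Literature.AnabelianGeometry.SemiGraphs.ArithmeticCoverings
import Mathlib.GroupTheory.Commutator.Basic
import Mathlib.Topology.Instances.AddCircle.Defs

/-!
# Sub-DAG of [SemiAnbd] Lemma 5.5 (decomposition groups of proper hyperbolic curves over finite fields): the printed proof, pp.66–67, cut into statements on abstract data

Mochizuki, *Semi-graphs of anabelioids*, Publ. RIMS **42** (2006); kurims manuscript
`paper:url-f33ace170ff4`, Lemma 5.5 (statement p.66 l.−12 – l.−8; proof p.66 l.−7 – p.67 l.12).
[cite: MochizukiSemiAnbd2006, Lem 5.5, p. 66]  Human ruling D-0068 (1) (statements-first sub-DAGs);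
cell file `plan/L3/SUBDAG-SemiAnbd-Lem55.md` (rows L01–L06 below = the rows of that table).

The node itself is `DecompositionGroupsDetermineStatement aug σ` (`ArithmeticCoverings.lean` l.356,
abc-iut-L3-t3; FACT-LIST F-1367, FACT-policy: consumed BY NAME, e.g. `SUBDAG-SemiAnbd-Thm54.md` row
T54-8).  Nothing here asserts it.  What this file does is type the PRINTED PROOF on the same abstract
data (an augmented group `Π_X ↠ G_k` with the sections `σ_x` of the `k`-points), so that the one
genuinely arithmetic input is isolated as a named statement and everything else is kernel-checked
group theory:

* L01 `JacobianQuotientStatement` — "x₀ determines a closed embedding `X ↪ J` whose induced morphism on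
  étale fundamental groups `Π_X ↠ Π_J` may be identified with the quotient of `Π_X` by the commutator
  subgroup of the kernel of the surjection `Π_X ↠ G_k`" (p.66 l.−3 – p.67 l.1): the Jacobian's group
  enters as abstract data `proj : Π_X →* Π_J`, `augJ : Π_J →* G_k`; the statement pins it.  GEOMETRIC
  INPUT (not asserted).  Consequence PROVED here: the kernel `T` of `augJ` is commutative
  (`kernelCommutative_of_jacobianQuotient`).
* L02 `AbelJacobiStatement` — the embedding on `k`-points `ι : X(k) ↪ J(k)` is injective and carries
  `σ_x` to (a conjugate of) `σ_{ι(x)}` (p.67 l.1–2 "Thus, it suffices to show that a point `a ∈ J(k)` is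
  determined by … `σ_a`").  GEOMETRIC INPUT (not asserted); the REDUCTION it affords is PROVED
  (`decompositionGroupsDetermine_of_abelJacobi`).
* L03 — "the difference between `σ_a` and `σ_0` may be thought of as an element `η_a ∈ H¹(k, T)`"
  (p.67 l.3–5): on abstract data, the difference `t ↦ σ_a(t)·σ_0(t)⁻¹` lands in `T` (`diff_mem_ker`),
  and `Π_J`-conjugate sections are already `T`-conjugate (`isKerConj_of_conj`, PROVED: the conjugator's
  image in `G_k` centralises `G_k`); `T`-conjugacy classes of sections of an extension with commutative
  kernel ARE `H¹(G_k, T)` via exactly this difference cocycle (K. S. Brown, *Cohomology of Groups* IV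
  (2.3); in the tree: `Literature.Algebra.Homology.ExtensionClass.conjClassesEquivH1`,
  `isConj_iff_H1π_eq`) — so `IsKerConj` below is the class `η` read without re-packaging `T` as a `Rep`.
* L04 `TateModuleStatement` — "`T ⥲ Hom(ℚ/ℤ, J(k̄))`" (p.67 l.5–7): a named statement on facade data
  (the `G_k`-module `J(k̄)`); ARITHMETIC-GEOMETRIC INPUT, not asserted, not consumed by L06 (recorded for
  faithfulness: it is what identifies `H¹(k, T)` with the Kummer theory of `J`).
* L05 `KummerIsoStatement` — "by well-known general nonsense [cf., e.g., [Naka], Claim (2.2); [NTs],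
  Lemma (4.14); [Mzk2], the Remark preceding Definition 6.2], there is a natural isomorphism
  `H¹(k, T) ⥲ J(k)`, which maps `η_a` to `a`" (p.67 l.7–10): on abstract data, `a ↦ η_a` (= the
  `T`-conjugacy class of `σ_a`) is a BIJECTION from `J(k)` onto the classes of sections.  THE cited
  FACT of the lemma (FACT-policy; not asserted).  Only its injectivity half `KummerInjectiveStatement` is
  load-bearing.
* L06 — "In particular, `η_a`, hence also `σ_a`, is sufficient to determine `a` itself" (p.67 l.10–11):
  PROVED assemblies `decompositionGroupsDetermine_of_kummerInjective` (for `J`) and `lemma55_of_steps`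
  (for `X`: node ⇐ L02 ∧ L05-injectivity; L01/L03 are used inside, L04 is provenance only).

"assume for simplicity that there exists a point `x₀ ∈ X(k)`" (p.66 l.−5): on abstract data the
statement quantifies over pairs of points, so the base point is the first of them; no separate row.
Deliberately NOT here: étale `π₁` of curves/Jacobians as real objects (TODO-merge abc-iut-L4-t1,
FOUNDATIONS row 12), Lang's theorem / finiteness of `J(k)` (inside L05's citation).  No instance, no
notation, no `sorry`; `Prop`-valued definitions with bodies and theorems only.  Typed ≠ proved for
L01/L02/L04/L05; no side taken on anything downstream ([IUTchIII] Cor 3.12).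
-/

namespace Literature.AnabelianGeometry.SemiGraphs

namespace Lem55

variable {PX Gk : Type*} [Group PX] [Group Gk] (aug : PX →* Gk)
variable {PJ : Type*} [Group PJ] (proj : PX →* PJ) (augJ : PJ →* Gk)

/-! ### L01 — the Jacobian quotient (p.66 l.−3 – p.67 l.1) -/

/-- **L01.** "`x₀` determines a closed embedding `X ↪ J` whose induced morphism on étale fundamental
groups `Π_X ↠ Π_J` may be identified with the quotient of `Π_X` by the commutator subgroup of the
kernel of the surjection `Π_X ↠ G_k`": `proj : Π_X → Π_J` is surjective, lies over `G_k`, and its kernel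
is `[Δ_X, Δ_X]`, `Δ_X := Ker(Π_X ↠ G_k)`.  A statement on abstract data; NOT asserted (geometric input:
`π₁` of the Jacobian). [cite: MochizukiSemiAnbd2006, Lem 5.5 proof, p. 66] -/
def JacobianQuotientStatement : Prop :=
  Function.Surjective proj ∧ augJ.comp proj = aug ∧ proj.ker = ⁅aug.ker, aug.ker⁆

/-- The kernel `T := Ker(Π_J ↠ G_k)` is commutative (the form in which L03 uses L01: "`T`" is an
abelian group, p.67 l.4–6). [cite: MochizukiSemiAnbd2006, Lem 5.5 proof, p. 67] -/
def KernelCommutativeStatement : Prop :=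
  ∀ a ∈ augJ.ker, ∀ b ∈ augJ.ker, a * b = b * a

/-- L01 ⇒ `T` is commutative: `T = Δ_X / [Δ_X, Δ_X]`. PROVED (group theory).
[cite: MochizukiSemiAnbd2006, Lem 5.5 proof, p. 67] -/
theorem kernelCommutative_of_jacobianQuotient (h : JacobianQuotientStatement aug proj augJ) :
    KernelCommutativeStatement augJ := by
  obtain ⟨hsurj, hcomp, hker⟩ := h
  intro a ha b hb
  obtain ⟨a', rfl⟩ := hsurj a
  obtain ⟨b', rfl⟩ := hsurj b
  have ha' : a' ∈ aug.ker := by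
    rw [MonoidHom.mem_ker, ← hcomp]; exact ha
  have hb' : b' ∈ aug.ker := by
    rw [MonoidHom.mem_ker, ← hcomp]; exact hb
  have hc : a' * b' * a'⁻¹ * b'⁻¹ ∈ proj.ker := by
    rw [hker]
    simpa [commutatorElement_def] using Subgroup.commutator_mem_commutator ha' hb'
  rw [MonoidHom.mem_ker, map_mul, map_mul, map_mul, map_inv, map_inv,
    mul_inv_eq_one, mul_inv_eq_iff_eq_mul] at hc
  exact hc

/-! ### L02 — reduction to the Jacobian (p.67 l.1–2) -/

variable {Pts : Type*} (σ : Pts → (Gk →* PX)) {JPts : Type*} (σJ : JPts → (Gk →* PJ)) (ι : Pts → JPts)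

/-- **L02.** The closed embedding `X ↪ J` on `k`-points, `ι : X(k) → J(k)`, is injective, and the
section of `x ∈ X(k)` maps under `Π_X ↠ Π_J` to the section of `ι(x)` up to `Π_J`-conjugacy
(functoriality of decomposition groups).  Statement on abstract data; NOT asserted (geometric input).
[cite: MochizukiSemiAnbd2006, Lem 5.5 proof, p. 67] -/
def AbelJacobiStatement : Prop :=
  Function.Injective ι ∧ ∀ x : Pts, ∃ g : PJ, ∀ t : Gk, σJ (ι x) t = g * proj (σ x t) * g⁻¹

/-- **L02, the reduction** "Thus, it suffices to show that a point `a ∈ J(k)` is determined by the outer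
homomorphism `σ_a : G_k → Π_J` that it induces": Lemma 5.5 for `(Π_J ↠ G_k, J(k))` and L02 give
Lemma 5.5 for `(Π_X ↠ G_k, X(k))`.  PROVED (group theory). [cite: MochizukiSemiAnbd2006, Lem 5.5 proof, p. 67] -/
theorem decompositionGroupsDetermine_of_abelJacobi (hAJ : AbelJacobiStatement proj σ σJ ι)
    (hsecJ : ∀ a : JPts, augJ.comp (σJ a) = MonoidHom.id Gk)
    (hJ : DecompositionGroupsDetermineStatement augJ σJ) :
    DecompositionGroupsDetermineStatement aug σ := by
  intro _ x y hxy
  obtain ⟨g, hg⟩ := hxy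
  obtain ⟨hι, hcompat⟩ := hAJ
  obtain ⟨gx, hgx⟩ := hcompat x
  obtain ⟨gy, hgy⟩ := hcompat y
  refine hι (hJ hsecJ (ι x) (ι y) ⟨gy * proj g * gx⁻¹, fun t => ?_⟩)
  have hx : proj (σ x t) = gx⁻¹ * σJ (ι x) t * gx := by
    rw [hgx t]; group
  rw [hgy t, hg t, map_mul, map_mul, map_inv, hx]
  group

/-! ### L03 — the difference class `η_a ∈ H¹(k, T)` (p.67 l.3–5) -/

/-- Two sections `s, s'` of `Π_J ↠ G_k` are `T`-CONJUGATE (`T = Ker`): the relation whose classes are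
`H¹(G_k, T)` when `T` is commutative (Brown IV (2.3); tree: `ExtensionClass.conjClassesEquivH1`) — i.e.
"`η(s) = η(s')`" read on abstract data. [cite: MochizukiSemiAnbd2006, Lem 5.5 proof, p. 67] -/
def IsKerConj (s s' : Gk →* PJ) : Prop :=
  ∃ τ ∈ augJ.ker, ∀ t : Gk, s' t = τ * s t * τ⁻¹

/-- The difference of two sections lands in `T`: "the difference between `σ_a` and `σ_0` may be thought
of as an element … [of] `H¹(k, T)`, where we define `T` to be the kernel of the natural surjection
`Π_J ↠ G_k`" — the cocycle `t ↦ σ_a(t) σ_0(t)⁻¹` is `T`-valued. PROVED.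
[cite: MochizukiSemiAnbd2006, Lem 5.5 proof, p. 67] -/
theorem diff_mem_ker (s s₀ : Gk →* PJ) (hs : augJ.comp s = MonoidHom.id Gk)
    (hs₀ : augJ.comp s₀ = MonoidHom.id Gk) (t : Gk) : s t * (s₀ t)⁻¹ ∈ augJ.ker := by
  have h1 : augJ (s t) = t := by simpa using DFunLike.congr_fun hs t
  have h2 : augJ (s₀ t) = t := by simpa using DFunLike.congr_fun hs₀ t
  rw [MonoidHom.mem_ker, map_mul, map_inv, h1, h2, mul_inv_cancel]

/-- Sections conjugate under an ARBITRARY `g ∈ Π_J` (the "outer homomorphism" equivalence of the lemma)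
are already `T`-conjugate: the image `γ` of `g` in `G_k` commutes with `G_k` (both are sections), and
`τ := g · s(γ)⁻¹ ∈ T` does the job.  This is why the `H¹` class of L03 is an invariant of the OUTER
homomorphism. PROVED (group theory). [cite: MochizukiSemiAnbd2006, Lem 5.5 proof, p. 67] -/
theorem isKerConj_of_conj (s s' : Gk →* PJ) (hs : augJ.comp s = MonoidHom.id Gk)
    (hs' : augJ.comp s' = MonoidHom.id Gk) (g : PJ) (hg : ∀ t : Gk, s' t = g * s t * g⁻¹) :
    IsKerConj augJ s s' := by
  have h1 : ∀ t, augJ (s t) = t := fun t => by simpa using DFunLike.congr_fun hs t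
  have h2 : ∀ t, augJ (s' t) = t := fun t => by simpa using DFunLike.congr_fun hs' t
  -- the image of `g` centralises `G_k`
  have hcomm : ∀ t : Gk, augJ g * t = t * augJ g := fun t => by
    have := h2 t
    rw [hg t, map_mul, map_mul, map_inv, h1 t] at this
    calc augJ g * t = augJ g * t * (augJ g)⁻¹ * augJ g := by group
      _ = t * augJ g := by rw [this]
  refine ⟨g * (s (augJ g))⁻¹, ?_, fun t => ?_⟩
  · rw [MonoidHom.mem_ker, map_mul, map_inv, h1, mul_inv_cancel]
  · have key : s (augJ g) * s t * (s (augJ g))⁻¹ = s t := by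
      rw [← map_mul, ← map_inv, ← map_mul, hcomm t, mul_inv_cancel_right]
    calc s' t = g * s t * g⁻¹ := hg t
      _ = g * (s (augJ g))⁻¹ * (s (augJ g) * s t * (s (augJ g))⁻¹) * (g * (s (augJ g))⁻¹)⁻¹ := by
          group
      _ = g * (s (augJ g))⁻¹ * s t * (g * (s (augJ g))⁻¹)⁻¹ := by rw [key]

/-! ### L04 — `T ⥲ Hom(ℚ/ℤ, J(k̄))` (p.67 l.5–7), facade -/

/-- **L04.** "we have a natural isomorphism `T ⥲ Hom(ℚ/ℤ, J(k̄))`, where `k̄` is the algebraic closure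
of `k` determined by the basepoint": on facade data — the `G_k`-module `J(k̄)` (`Jbar`, with `G_k`
acting through `act`, a bare function — facade) — a bijection `e : T → Hom(ℚ/ℤ, J(k̄))` (`ℚ/ℤ = AddCircle (1 : ℚ)`) that is
multiplicative-to-additive and `G_k`-equivariant for the conjugation action on `T` through sections.
PROVENANCE ROW: not asserted and not consumed by L06. [cite: MochizukiSemiAnbd2006, Lem 5.5 proof, p. 67] -/
def TateModuleStatement {Jbar : Type*} [AddCommGroup Jbar] (act : Gk → (Jbar →+ Jbar))
    (e : augJ.ker → (AddCircle (1 : ℚ) →+ Jbar)) : Prop :=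
  Function.Bijective e ∧ (∀ a b : augJ.ker, e (a * b) = e a + e b) ∧
    ∀ (g : PJ) (a : augJ.ker),
      e ⟨g * a * g⁻¹, (MonoidHom.normal_ker augJ).conj_mem (a : PJ) a.2 g⟩ =
        (act (augJ g)).comp (e a)

/-! ### L05 — the cited fact `H¹(k, T) ⥲ J(k)`, `η_a ↦ a` (p.67 l.7–10) -/

/-- **L05 (the FACT of the lemma).** "by well-known general nonsense [cf., e.g., [Naka], Claim (2.2);
[NTs], Lemma (4.14); [Mzk2], the Remark preceding Definition 6.2], there is a natural isomorphism
`H¹(k, T) ⥲ J(k)`, which maps `η_a` to `a`": on abstract data, `a ↦ η_a` (the `T`-conjugacy class of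
`σ_a`, L03) is a bijection from `J(k)` onto the `T`-conjugacy classes of sections of `Π_J ↠ G_k`.
FACT-policy: NOT asserted (inputs in print: Kummer theory of the abelian variety `J` over the FINITE
field `k`). [cite: MochizukiSemiAnbd2006, Lem 5.5 proof, p. 67] -/
def KummerIsoStatement : Prop :=
  (∀ a b : JPts, IsKerConj augJ (σJ a) (σJ b) → a = b) ∧
    ∀ s : Gk →* PJ, augJ.comp s = MonoidHom.id Gk → ∃ a : JPts, IsKerConj augJ (σJ a) s

/-- The load-bearing half of L05: `a ↦ η_a` is INJECTIVE ("`η_a` … is sufficient to determine `a`").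
FACT-policy: NOT asserted. [cite: MochizukiSemiAnbd2006, Lem 5.5 proof, p. 67] -/
def KummerInjectiveStatement : Prop :=
  ∀ a b : JPts, IsKerConj augJ (σJ a) (σJ b) → a = b

/-- L05 ⇒ its injectivity half. [cite: MochizukiSemiAnbd2006, Lem 5.5 proof, p. 67] -/
theorem kummerInjective_of_kummerIso (h : KummerIsoStatement augJ σJ) :
    KummerInjectiveStatement augJ σJ :=
  h.1

/-! ### L06 — assembly (p.67 l.10–11) -/

/-- **L06 for `J`.** "In particular, `η_a`, hence also `σ_a`, is sufficient to determine `a` itself":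
Lemma 5.5 for `(Π_J ↠ G_k, J(k))` ⇐ L05-injectivity, via L03 (`isKerConj_of_conj`). PROVED.
[cite: MochizukiSemiAnbd2006, Lem 5.5 proof, p. 67] -/
theorem decompositionGroupsDetermine_of_kummerInjective (hK : KummerInjectiveStatement augJ σJ) :
    DecompositionGroupsDetermineStatement augJ σJ := by
  intro hsec a b hab
  obtain ⟨g, hg⟩ := hab
  exact hK a b (isKerConj_of_conj augJ (σJ a) (σJ b) (hsec a) (hsec b) g hg)

/-- **L06 for `X` (the lemma from its cut).** [SemiAnbd] Lemma 5.5 on abstract data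
(`DecompositionGroupsDetermineStatement aug σ`, the cone's named fact F-1367) FOLLOWS from the two
named inputs L02 (Abel–Jacobi on `k`-points with section functoriality) and L05-injectivity (Kummer),
the sections of `J(k)` being sections.  PROVED; the inputs are NOT asserted, so nothing here discharges
F-1367 — it REDUCES it. [cite: MochizukiSemiAnbd2006, Lem 5.5, p. 66] -/
theorem lemma55_of_steps (hAJ : AbelJacobiStatement proj σ σJ ι)
    (hsecJ : ∀ a : JPts, augJ.comp (σJ a) = MonoidHom.id Gk)
    (hK : KummerInjectiveStatement augJ σJ) :
    DecompositionGroupsDetermineStatement aug σ :=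
  decompositionGroupsDetermine_of_abelJacobi aug proj augJ σ σJ ι hAJ hsecJ
    (decompositionGroupsDetermine_of_kummerInjective augJ σJ hK)

end Lem55

end Literature.AnabelianGeometry.SemiGraphs
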